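import Mathlib
import Summits.NavierStokesRegularity.NavierStokesRegularity.Theorems.TaoLadderRungTwoBreakOneShiftWindowTermField
import Summits.NavierStokesRegularity.NavierStokesRegularity.Theorems.TaoLadderRungTwoBreakOneShiftWindowRunClauses
import HarnessLib

/-!
# The one-shift window system, XIX: the window field and the window runs in FLAT COORDINATES `Fin m × Fin W → ℝ`
# — the window field IS a term-list field (part XVIII), so it has the declared x-Jacobian with entries `jacEntry`,
# and every run from admissible data is a solution of it in the sense the generic parts XIV–XVII consume
# (cell harvest/h2-tao-ladder, seat p2; rung1/KERNEL-CHEAP-REPLAY-SPEC.md §7 (R1)/(R3); support for K1(1) =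
# `NoSurvivingDSSOne`, stmt-NavierStokesRegularity-20205)

MODEL lattice ODEs only (Tao 2016 §4 normal form on Tao's shift set `S`); nothing here is a statement about
the Navier–Stokes equations; no item is closed; nothing numerical is proved.

* `SIdx` (= `Fin m × Fin W`), `curryS` (flat vector ↦ window state), `flatRun S t` (the window values of a family at
  time `t` as a flat vector);
* `factorAt T t i k` — the factor of the window field for the lattice site `(i, k)`: the coordinate `(i, k)` on the
  window, the external value `T_{i,k}(t)` off it; `val_factorAt`;
* `wterms ε₀ α T t` — the term list of the window field at time `t` with tails `T` (index: output `(i,j)`, `i₁`, `i₂`,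
  `μ ∈ S`); `termField_wterms` — **`termField (wterms T t) x (i, j) = wfield ε₀ α T t (curryS x) i j`**;
* `wfieldFlat`, `hasFDerivAt_wfieldFlat` (+ `Within`), entries `= jacEntry (wterms T t)`;
* `hasDerivWithinAt_flatRun` — a run from admissible data (`IsRunFrom`, part VI) is, in flat coordinates, a
  solution of `x' = wfieldFlat T t x` within the flight interval — the hypothesis shape of parts XVI/XVII.
-/

noncomputable section

-- the sub-problem namespace repeats the summit name by design (D-0017)
set_option linter.dupNamespace false

namespace Summit.NavierStokesRegularity.NavierStokesRegularity.Theorems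

namespace DSSOneShift

open Set Metric Literature.Analysis.FluidPDE Literature.Analysis.FluidPDE.TaoCascade CertificateGlueOn

variable {m : ℕ}

namespace OneShiftFrame

variable (F : OneShiftFrame m)

/-! ### Flat coordinates -/

/-- The flat state index `(mode, window shell)`. [folklore] -/
abbrev SIdx : Type := Fin m × Fin F.W

/-- A flat vector as a window state. [folklore] -/
def curryS (x : F.SIdx → ℝ) : F.WState := fun i j => x (i, j)

/-- The window values of a lattice family at time `t`, as a flat vector. [folklore] -/
def flatRun (S : Fin m → ℤ → ℝ → ℝ) (t : ℝ) : F.SIdx → ℝ := fun c => S c.1 ((c.2 : ℕ) : ℤ) t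

/-! ### The window field as a term list -/

/-- The factor of the window field for the lattice site `(i, k)` at time `t` with tails `T`: the flat coordinate
`(i, k)` if `k` is a window shell, the external value `T_{i,k}(t)` otherwise. [cite: Tao2016AveragedNS, §4 (4.8); cell vocabulary, harvest/h2-tao-ladder rung1/KERNEL-CHEAP-REPLAY-SPEC.md §1] -/
def factorAt (T : Fin m → ℤ → ℝ → ℝ) (t : ℝ) (i : Fin m) (k : ℤ) : Factor F.SIdx :=
  if h : F.InWindow k then Factor.coord (i, F.widx h) else Factor.ext (T i k t)

/-- The factor's value is the assembled family's value. [folklore] -/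
theorem val_factorAt (T : Fin m → ℤ → ℝ → ℝ) (t : ℝ) (x : F.SIdx → ℝ) (i : Fin m) (k : ℤ) :
    (F.factorAt T t i k).val x = F.assemble (F.curryS x) T i k t := by
  unfold factorAt assemble
  by_cases h : F.InWindow k
  · simp [dif_pos h, Factor.val, curryS]
  · simp [dif_neg h, Factor.val]

/-- The term index of the window field: output `(i, j)`, modes `i₁, i₂`, shift `μ ∈ S`. [folklore] -/
abbrev TIdx : Type := F.SIdx × Fin m × Fin m × (shiftSet : Set (ℤ × ℤ × ℤ))

/-- **The term list of the window field** at time `t` with tails `T`: for output `(i, j)` and `(i₁, i₂, μ)` the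
term `α_{i₁ i₂ i μ} (1+ε₀)^{5(j−μ₃)/2} · X_{i₁, j−μ₃+μ₁} · X_{i₂, j−μ₃+μ₂}` of (4.8). [cite: Tao2016AveragedNS, §4 Lemma 4.1 (4.8); cell vocabulary, harvest/h2-tao-ladder rung1/KERNEL-CHEAP-REPLAY-SPEC.md §1 (term list)] -/
def wterms (ε₀ : ℝ) (α : Fin m → Fin m → Fin m → ℤ × ℤ × ℤ → ℝ) (T : Fin m → ℤ → ℝ → ℝ) (t : ℝ) :
    F.TIdx → BTerm F.SIdx := fun q =>
  { out := q.1
    coef := α q.2.1 q.2.2.1 q.1.1 q.2.2.2.1 * (1 + ε₀) ^ ((5 : ℝ) * (((q.1.2 : ℕ) : ℤ) - q.2.2.2.1.2.2) / 2)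
    fa := F.factorAt T t q.2.1 (((q.1.2 : ℕ) : ℤ) - q.2.2.2.1.2.2 + q.2.2.2.1.1)
    fb := F.factorAt T t q.2.2.1 (((q.1.2 : ℕ) : ℤ) - q.2.2.2.1.2.2 + q.2.2.2.1.2.1) }

/-- **The window field is the term-list field of `wterms`.** [cite: Tao2016AveragedNS, §4 Lemma 4.1 (4.8); cell vocabulary, window-truncated with edge inputs] -/
theorem termField_wterms (ε₀ : ℝ) (α : Fin m → Fin m → Fin m → ℤ × ℤ × ℤ → ℝ) (T : Fin m → ℤ → ℝ → ℝ)
    (t : ℝ) (x : F.SIdx → ℝ) (c : F.SIdx) :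
    termField (F.wterms ε₀ α T t) x c = F.wfield ε₀ α T t (F.curryS x) c.1 c.2 := by
  classical
  rcases c with ⟨i, j⟩
  rw [termField, wfield, quadTerm, Fintype.sum_prod_type]
  -- collapse the output index
  have hcollapse : ∀ q' : Fin m × Fin m × (shiftSet : Set (ℤ × ℤ × ℤ)), ∑ o : F.SIdx,
      (F.wterms ε₀ α T t (o, q')).coefAt (i, j) * (F.wterms ε₀ α T t (o, q')).fa.val x *
        (F.wterms ε₀ α T t (o, q')).fb.val x =
      (F.wterms ε₀ α T t ((i, j), q')).coef * (F.wterms ε₀ α T t ((i, j), q')).fa.val x *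
        (F.wterms ε₀ α T t ((i, j), q')).fb.val x := by
    intro q'
    have : ∀ o : F.SIdx, (F.wterms ε₀ α T t (o, q')).coefAt (i, j) * (F.wterms ε₀ α T t (o, q')).fa.val x *
        (F.wterms ε₀ α T t (o, q')).fb.val x =
        if o = (i, j) then (F.wterms ε₀ α T t ((i, j), q')).coef * (F.wterms ε₀ α T t ((i, j), q')).fa.val x *
          (F.wterms ε₀ α T t ((i, j), q')).fb.val x else 0 := by
      intro o
      by_cases ho : o = (i, j)
      · subst ho; simp [BTerm.coefAt, wterms]
      · simp [BTerm.coefAt, wterms, ho]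
    simp_rw [this]
    simp
  have hswap : ∑ o : F.SIdx, ∑ q' : Fin m × Fin m × (shiftSet : Set (ℤ × ℤ × ℤ)),
      (F.wterms ε₀ α T t (o, q')).coefAt (i, j) * (F.wterms ε₀ α T t (o, q')).fa.val x *
        (F.wterms ε₀ α T t (o, q')).fb.val x =
      ∑ q' : Fin m × Fin m × (shiftSet : Set (ℤ × ℤ × ℤ)),
        (F.wterms ε₀ α T t ((i, j), q')).coef * (F.wterms ε₀ α T t ((i, j), q')).fa.val x *
          (F.wterms ε₀ α T t ((i, j), q')).fb.val x := by
    rw [Finset.sum_comm]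
    exact Finset.sum_congr rfl fun q' _ => hcollapse q'
  rw [hswap, Fintype.sum_prod_type, Finset.sum_congr rfl fun i₁ _ => Fintype.sum_prod_type ..]
  refine Finset.sum_congr rfl fun i₁ _ => Finset.sum_congr rfl fun i₂ _ => ?_
  rw [← Finset.sum_coe_sort shiftSet]
  refine Finset.sum_congr rfl fun μ _ => ?_
  simp only [wterms, val_factorAt]
  ring

/-- **The window field in flat coordinates.** [cite: Tao2016AveragedNS, §4 Lemma 4.1 (4.8); cell vocabulary, window-truncated with edge inputs] -/
def wfieldFlat (ε₀ : ℝ) (α : Fin m → Fin m → Fin m → ℤ × ℤ × ℤ → ℝ) (T : Fin m → ℤ → ℝ → ℝ) (t : ℝ)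
    (x : F.SIdx → ℝ) : F.SIdx → ℝ :=
  fun c => F.wfield ε₀ α T t (F.curryS x) c.1 c.2

/-- The flat window field is the term-list field. [folklore] -/
theorem wfieldFlat_eq_termField (ε₀ : ℝ) (α : Fin m → Fin m → Fin m → ℤ × ℤ × ℤ → ℝ)
    (T : Fin m → ℤ → ℝ → ℝ) (t : ℝ) : F.wfieldFlat ε₀ α T t = termField (F.wterms ε₀ α T t) := by
  funext x c; exact (F.termField_wterms ε₀ α T t x c).symm

/-- **The x-Jacobian of the window field** (flat coordinates): at every state the derivative `termFieldDeriv` of the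
term list, whose entries are `jacEntry (wterms T t)`. [cite: Tao2016AveragedNS, §4 Lemma 4.1 (4.8); cell vocabulary, harvest/h2-tao-ladder rung1/KERNEL-CHEAP-REPLAY-SPEC.md §7 (R1)] -/
theorem hasFDerivAt_wfieldFlat (ε₀ : ℝ) (α : Fin m → Fin m → Fin m → ℤ × ℤ × ℤ → ℝ) (T : Fin m → ℤ → ℝ → ℝ)
    (t : ℝ) (x : F.SIdx → ℝ) :
    HasFDerivAt (F.wfieldFlat ε₀ α T t) (termFieldDeriv (F.wterms ε₀ α T t) x) x := by
  rw [wfieldFlat_eq_termField]; exact hasFDerivAt_termField _ x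

/-- The same within any set (the step hull). [folklore] -/
theorem hasFDerivWithinAt_wfieldFlat (ε₀ : ℝ) (α : Fin m → Fin m → Fin m → ℤ × ℤ × ℤ → ℝ)
    (T : Fin m → ℤ → ℝ → ℝ) (t : ℝ) (s : Set (F.SIdx → ℝ)) (x : F.SIdx → ℝ) :
    HasFDerivWithinAt (F.wfieldFlat ε₀ α T t) (termFieldDeriv (F.wterms ε₀ α T t) x) s x :=
  (F.hasFDerivAt_wfieldFlat ε₀ α T t x).hasFDerivWithinAt

/-! ### Runs in flat coordinates -/

/-- A family that equals the tails off the window is, at each time, the assembled family of its flat window values.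
[folklore] -/
theorem assemble_curryS_flatRun {S : Fin m → ℤ → ℝ → ℝ} {T : Fin m → ℤ → ℝ → ℝ}
    (htail : ∀ i k, ¬ F.InWindow k → S i k = T i k) (t : ℝ) (i : Fin m) (k : ℤ) :
    F.assemble (F.curryS (F.flatRun S t)) T i k t = S i k t := by
  unfold assemble
  by_cases h : F.InWindow k
  · simp only [dif_pos h, curryS, flatRun, F.natCast_widx h]
  · rw [dif_neg h, htail i k h]

/-- **A run from admissible data is a flat solution of the window field.** For `S` with
`IsRunFrom ε₀ α y T S` (part VI): in flat coordinates, `t ↦ flatRun S t` has within the flight interval the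
derivative `wfieldFlat T t (flatRun S t)` — the hypothesis shape `hSu`/`hS` of parts XVI/XVII.
[cite: Tao2016AveragedNS, §4 Lemma 4.1 (4.8); cell vocabulary, harvest/h2-tao-ladder rung1/KERNEL-CHEAP-REPLAY-SPEC.md §7 (R3)] -/
theorem hasDerivWithinAt_flatRun {ε₀ : ℝ} {α : Fin m → Fin m → Fin m → ℤ × ℤ × ℤ → ℝ} {y : Fin m → ℤ → ℝ}
    {T S : Fin m → ℤ → ℝ → ℝ} (hS : F.IsRunFrom ε₀ α y T S) {t : ℝ} (ht : t ∈ Icc 0 F.τhi) :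
    HasDerivWithinAt (F.flatRun S) (F.wfieldFlat ε₀ α T t (F.flatRun S t)) (Icc 0 F.τhi) t := by
  refine hasDerivWithinAt_pi.2 fun c => ?_
  have hk0 : -(0 : ℤ) ≤ ((c.2 : ℕ) : ℤ) := by simp
  have hk1 : ((c.2 : ℕ) : ℤ) ≤ (F.W : ℤ) - 1 := by have := c.2.2; omega
  have hd := hS.1.deriv c.1 ((c.2 : ℕ) : ℤ) hk0 hk1 t ht
  have hval : quadTermOn shiftSet ε₀ α S c.1 ((c.2 : ℕ) : ℤ) t = F.wfieldFlat ε₀ α T t (F.flatRun S t) c := by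
    rw [quadTermOn_shiftSet, wfieldFlat, wfield]
    exact quadTerm_congr_at (fun i k => (F.assemble_curryS_flatRun hS.2.2 t i k).symm) c.1 _
  rw [← hval]
  exact hd

end OneShiftFrame

end DSSOneShift

end Summit.NavierStokesRegularity.NavierStokesRegularity.Theorems
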